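import Mathlib
import Literature.MathematicalPhysics.MHD.BallooningSAlpha
import Summits.Ventures.FusionMHD.Models.SAlphaRiccatiEnergy
import HarnessLib

/-!
# F3 row «F3.BALLOON-sα-STABLE-WINDOW»: at unit shear and `α = 2/5` the `s–α` MODEL carries NO negative-energy trial function supported in the two-turn window `[−2π, 2π]` — an explicit Riccati supersolution `w = f′/f − ΛΛ′/(1+Λ²)`, `f = 1 − 11θ²/500`, with residual `≤ 0` proved by hand (Taylor bounds for `sin`, `cos` near `0`, monotonicity of `cos`, and two coarse regimes)

LADDER-GRIDFUSION rung F3 (cell `gridfusion`; lead g12 RULINGS 9ew (2) / 9ey (2): «#199-cand F3.BALLOON-sα-STABLE-WINDOW-THM» —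
the TWO-SIDED closure of the ballooning lane at `s = 1`: ★ #192's two-turn witness `X_tt` is a NEGATIVE direction at
`(1, 67/100)` on the SAME window `[−2π, 2π]`; here, at `(1, 2/5)`, no function on that window is).  Statements + proofs by
gridfusion-model-7 g8, 2026-08-28; engine `SAlphaRiccatiEnergy` (Picone in Riccati form); objects lit-3's `BallooningSAlpha`.
0 kit, 0 named facts, no `native_decide`, no `decide`; the only numerics are Mathlib's `Real.sin_bound` / `Real.cos_bound`
(Taylor remainders on `|θ| ≤ 1`), `Real.sin_le`, `Real.cos_le_cos_of_nonneg_of_le_pi`,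
`Real.cos_nonpos_of_pi_div_two_le_of_le` and `3.14 < π < 3.15`.

## The certificate (s = 1, α = 2/5; `Λ = θ − (2/5) sin θ`, `Λ′ = 1 − (2/5) cos θ`, `p = 1 + Λ²`, `q = (2/5)(Λ sin θ + cos θ)`)
* `f(θ) = 1 − 11θ²/500` (positive for `θ² < 500/11`, in particular on `[−2π, 2π]`), `w = f′/f − ΛΛ′/p` — the log-derivative
  of `u = f·p^{-1/2}`; the Riccati residual is `Ric = (pw)′ + pw² + q = E/(p f)` with
  `E = p² f″ + f·((2/5) p cos θ − Λ′²) = −(11/250)p²(1 − f) − f·K`, `K := (11/250)p² + Λ′² − (2/5) p cos θ`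
  (`riccati_eq`, `E_eq`; pure algebra, the identity `((1+Λ²)^{-1/2})` never appears: `p·u₀² = 1` kills the first-order term);
* `K ≥ 0` for EVERY real `θ` (`K_nonneg`): on `[0, 3/4]` by the Taylor bounds (`K = 1/250 − (39/125)Λ² + (22/25)(1 − cos θ) +`
  non-negative terms, `Λ ≤ 0.6465 θ`, `1 − cos θ ≥ 0.47 θ²`); on `[3/4, π]` because `cos θ ≤ cos(3/4) ≤ 18069/24576` makes the
  quadratic `(11/250)p² − (2/5)(cos θ)p + Λ′²` in `p` non-negative (`= (11/250)(p − 50 cos θ/11)² + (1 − 2cos θ/5)² − (10/11)cos²θ`);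
  on `[π/2, 3π/2]` because `cos θ ≤ 0`; on `[4, ∞)` because `p ≥ 13.96`; and `K(−θ) = K(θ)`;
* hence `E ≤ 0` and `Ric ≤ 0` wherever `0 < f ≤ 1`, in particular on `[−2π, 2π]` (`riccati_nonpos`);
* `SAlphaRiccati.not_unstableWitness_of_riccati` then gives the row: **no `SAlpha.UnstableWitness 1 (2/5) a b X X′` with
  `−2π ≤ a`, `b ≤ 2π`** (`not_unstableWitness_window`), and `0 ≤ W[X; a, b]` for every differentiable `X` vanishing at `a, b`
  with integrable density (`energy_nonneg_window`).

## THREE COLUMNS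
CERTIFIED: in the `s–α` ballooning MODEL (Freidberg (12.96)–(12.99)) at `(s, α) = (1, 2/5)`: every trial function `X`,
differentiable on `[a, b] ⊆ [−2π, 2π]` with `X(a) = X(b) = 0` (and integrable energy density), has one-surface energy
`W[X; a, b] ≥ 0`; equivalently no `SAlpha.UnstableWitness` is supported in the two-turn window — whereas at `(1, 67/100)` the
same window carries one (★ #192, `SAlphaTwoTurnBump.unstableWitness_tt_one_067`).  VALIDATED (not in the kernel): model-7's
RK4/Newcomb shooting puts the MODEL's first-stability edge at `s = 1` at `α ≈ 0.613` (the printed fit (12.100) gives `0.6`), so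
`2/5` is `35 %` inside the stable side and `67/100` is `9 %` inside the unstable side; the exact even solution of (12.97) at
`(1, 2/5)` is positive on all of `ℝ` (float), i.e. the full-line statement is expected — NOT claimed here.  MODELLED: `s–α` model
(large-aspect-ratio shifted circles, high-`n` ballooning ordering, `θ₀ = 0`, ideal MHD); «stable on the window» = no negative
trial function supported in `[−2π, 2π]`; the WINDOW is a restriction (functions with longer support are not covered by this
file); the step from the one-surface functional to the 2-D `δW` (Connor–Hastie–Taylor 1979) is quoted in lit-3's file, not typed;
no device, no `β`-limit.  Citations: Freidberg 2014 §12.3 (12.38)–(12.40), §12.6.2 (12.96)–(12.100) [Freidberg2014]; Hartman 2002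
Ch. XI Thm. 6.2 (Picone) [Hartman2002].  Everything below is [instance data].
-/

noncomputable section

open Real MeasureTheory intervalIntegral Set
open Literature.MathematicalPhysics.MHD.Ballooning

namespace Summit.Ventures.FusionMHD.Models

namespace SAlphaStableWindow

/-! ### §1 The certificate functions at `(s, α) = (1, 2/5)` -/

/-- The inner factor `f(θ) = 1 − 11θ²/500` of the supersolution `u = f·(1+Λ²)^{-1/2}`. [instance data] -/
def fI (θ : ℝ) : ℝ := 1 - 11 / 500 * θ ^ 2

/-- The log-derivative field `w = f′/f − ΛΛ′/(1+Λ²)` (`= u′/u`). [instance data] -/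
def wI (θ : ℝ) : ℝ :=
  -(11 / 250) * θ / fI θ
    - SAlpha.shearParam 1 (2 / 5) θ * SAlpha.localShear 1 (2 / 5) θ / SAlpha.bending 1 (2 / 5) θ

/-- The derivative of `(1+Λ²)·w = −(11/250)θ(1+Λ²)/f − ΛΛ′` (formal: `Λ″ = (2/5) sin θ`, `f′ = −(11/250)θ`). [instance data] -/
def pwI' (θ : ℝ) : ℝ :=
  -(11 / 250) * ((SAlpha.bending 1 (2 / 5) θ + θ * (2 * SAlpha.shearParam 1 (2 / 5) θ * SAlpha.localShear 1 (2 / 5) θ))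
      * fI θ - θ * SAlpha.bending 1 (2 / 5) θ * (-(11 / 250) * θ)) / fI θ ^ 2
    - (SAlpha.localShear 1 (2 / 5) θ * SAlpha.localShear 1 (2 / 5) θ
        + SAlpha.shearParam 1 (2 / 5) θ * (2 / 5 * Real.sin θ))

/-- `E = p² f″ + f((2/5) p cos θ − Λ′²)` — the numerator of the Riccati residual (`Ric = E/(p f)`). [instance data] -/
def EI (θ : ℝ) : ℝ :=
  -(11 / 250) * SAlpha.bending 1 (2 / 5) θ ^ 2
    + fI θ * (2 / 5 * SAlpha.bending 1 (2 / 5) θ * Real.cos θ - SAlpha.localShear 1 (2 / 5) θ ^ 2)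

/-- `K = (11/250)p² + Λ′² − (2/5) p cos θ` — the quantity whose non-negativity on `ℝ` drives the certificate
(`E = −(11/250)p²(1 − f) − f·K`). [instance data] -/
def KI (θ : ℝ) : ℝ :=
  11 / 250 * SAlpha.bending 1 (2 / 5) θ ^ 2 + SAlpha.localShear 1 (2 / 5) θ ^ 2
    - 2 / 5 * SAlpha.bending 1 (2 / 5) θ * Real.cos θ

/-- `E = −(11/250)p²(1 − f) − f·K` (pure algebra). [instance data] -/
theorem EI_eq (θ : ℝ) : EI θ = -(11 / 250) * SAlpha.bending 1 (2 / 5) θ ^ 2 * (1 - fI θ) - fI θ * KI θ := by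
  unfold EI KI; ring

/-! ### §2 `K ≥ 0` on the whole line -/

/-- `K` is even. [instance data] -/
theorem KI_neg (θ : ℝ) : KI (-θ) = KI θ := by
  unfold KI SAlpha.bending SAlpha.shearParam SAlpha.localShear
  simp only [Real.sin_neg, Real.cos_neg]
  ring

/-- Region A, `0 ≤ θ ≤ 3/4`: fourth-order Taylor bounds give `Λ ≤ 0.6465 θ`, `1 − cos θ ≥ 0.47 θ²`, and then
`K ≥ 1/250 + 0.28 θ² ≥ 0`. [instance data] -/
theorem KI_nonneg_A {θ : ℝ} (h0 : 0 ≤ θ) (h1 : θ ≤ 3 / 4) : 0 ≤ KI θ := by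
  have hθ1 : |θ| ≤ 1 := by rw [abs_of_nonneg h0]; linarith
  have hsb := Real.sin_bound hθ1
  have hcb := Real.cos_bound hθ1
  rw [abs_of_nonneg h0] at hsb hcb
  have hs_lo : θ - θ ^ 3 / 6 - θ ^ 5 / 100 ≤ Real.sin θ := by
    have := (abs_le.1 hsb).1; linarith
  have hc_hi : Real.cos θ ≤ 1 - θ ^ 2 / 2 + θ ^ 4 * (5 / 96) := by
    have := (abs_le.1 hcb).2; linarith
  have hs_hi : Real.sin θ ≤ θ := Real.sin_le h0
  have hθ2 : θ ^ 2 ≤ 9 / 16 := by nlinarith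
  have hθ3 : θ ^ 3 ≤ 9 / 16 * θ := by nlinarith
  have hθ4 : θ ^ 4 ≤ 9 / 16 * θ ^ 2 := by nlinarith
  have hθ5 : θ ^ 5 ≤ 81 / 256 * θ := by nlinarith
  -- Λ bounds
  have hΛlo : 0 ≤ θ - 2 / 5 * Real.sin θ := by linarith
  have hΛhi : θ - 2 / 5 * Real.sin θ ≤ 6465 / 10000 * θ := by nlinarith
  have hΛsq : (θ - 2 / 5 * Real.sin θ) ^ 2 ≤ (6465 / 10000) ^ 2 * θ ^ 2 := by
    have := mul_le_mul hΛhi hΛhi hΛlo (by linarith)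
    nlinarith
  -- 1 − cos θ bound
  have hγ : 47 / 100 * θ ^ 2 ≤ 1 - Real.cos θ := by nlinarith
  have hγ0 : 0 ≤ 1 - Real.cos θ := by nlinarith
  unfold KI SAlpha.bending SAlpha.shearParam SAlpha.localShear
  have hL4 : 0 ≤ (1 * θ - 2 / 5 * Real.sin θ) ^ 2 := sq_nonneg _
  nlinarith [mul_nonneg hL4 hγ0, sq_nonneg (1 - Real.cos θ), sq_nonneg ((1 * θ - 2 / 5 * Real.sin θ) ^ 2)]

/-- `cos(3/4) ≤ 18069/24576 (≈ 0.73523)` from the fourth-order Taylor bound. [instance data] -/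
theorem cos_three_quarters_le : Real.cos (3 / 4) ≤ 18069 / 24576 := by
  have h : |(3 / 4 : ℝ)| ≤ 1 := by rw [abs_of_nonneg (by norm_num)]; norm_num
  have hcb := Real.cos_bound h
  rw [abs_of_nonneg (by norm_num : (0:ℝ) ≤ 3 / 4)] at hcb
  have := (abs_le.1 hcb).2
  nlinarith

/-- Region B1, `3/4 ≤ θ ≤ π`: `cos θ ≤ cos(3/4) < 0.7353` makes the quadratic in `p` non-negative
(`K = (11/250)(p − 50cos θ/11)² + (1 − 2cos θ/5)² − (10/11)cos²θ`). [instance data] -/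
theorem KI_nonneg_B1 {θ : ℝ} (h0 : 3 / 4 ≤ θ) (h1 : θ ≤ π) : 0 ≤ KI θ := by
  have hC : Real.cos θ ≤ Real.cos (3 / 4) := Real.cos_le_cos_of_nonneg_of_le_pi (by norm_num) h1 h0
  have hC' : Real.cos θ ≤ 18069 / 24576 := hC.trans cos_three_quarters_le
  have hC1 : -1 ≤ Real.cos θ := Real.neg_one_le_cos θ
  unfold KI SAlpha.localShear
  set p := SAlpha.bending 1 (2 / 5) θ
  set C := Real.cos θ
  nlinarith [sq_nonneg (p - 50 / 11 * C), mul_nonneg (sub_nonneg.2 hC') (by linarith : 0 ≤ C + 1)]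

/-- Region B2, `π/2 ≤ θ ≤ 3π/2`: `cos θ ≤ 0`, all three terms of `K` are non-negative. [instance data] -/
theorem KI_nonneg_B2 {θ : ℝ} (h0 : π / 2 ≤ θ) (h1 : θ ≤ 3 * π / 2) : 0 ≤ KI θ := by
  have hC : Real.cos θ ≤ 0 := Real.cos_nonpos_of_pi_div_two_le_of_le h0 (by linarith)
  have hp : 0 < SAlpha.bending 1 (2 / 5) θ := SAlpha.bending_pos 1 (2 / 5) θ
  unfold KI
  nlinarith [sq_nonneg (SAlpha.localShear 1 (2 / 5) θ), sq_nonneg (SAlpha.bending 1 (2 / 5) θ), mul_nonneg hp.le (neg_nonneg.2 hC)]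

/-- Region C, `4 ≤ θ`: `Λ ≥ θ − 2/5 ≥ 3.6`, `p ≥ 13.96`, `(11/250)p ≥ 0.61 > 2/5 ≥ (2/5)cos θ`. [instance data] -/
theorem KI_nonneg_C {θ : ℝ} (h0 : 4 ≤ θ) : 0 ≤ KI θ := by
  have hS : Real.sin θ ≤ 1 := Real.sin_le_one θ
  have hC : Real.cos θ ≤ 1 := Real.cos_le_one θ
  have hΛ : 18 / 5 ≤ 1 * θ - 2 / 5 * Real.sin θ := by linarith
  have hp : 13 ≤ SAlpha.bending 1 (2 / 5) θ := by
    unfold SAlpha.bending SAlpha.shearParam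
    nlinarith
  unfold KI
  nlinarith [sq_nonneg (SAlpha.localShear 1 (2 / 5) θ), mul_nonneg (by linarith : (0:ℝ) ≤ SAlpha.bending 1 (2 / 5) θ) (sub_nonneg.2 hC)]

/-- `K ≥ 0` for `θ ≥ 0` (regions A ∪ B1 ∪ B2 ∪ C cover `[0, ∞)` since `3 < π` and `4 < 3π/2`). [instance data] -/
theorem KI_nonneg_of_nonneg {θ : ℝ} (h0 : 0 ≤ θ) : 0 ≤ KI θ := by
  have hπ := Real.pi_gt_three
  rcases le_or_gt θ (3 / 4) with h | h
  · exact KI_nonneg_A h0 h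
  rcases le_or_gt θ π with h' | h'
  · exact KI_nonneg_B1 h.le h'
  rcases le_or_gt θ 4 with h'' | h''
  · exact KI_nonneg_B2 (by linarith) (by linarith)
  · exact KI_nonneg_C h''.le

/-- `K ≥ 0` on the whole line (evenness). [instance data] -/
theorem KI_nonneg (θ : ℝ) : 0 ≤ KI θ := by
  rcases le_or_gt 0 θ with h | h
  · exact KI_nonneg_of_nonneg h
  · rw [← KI_neg]; exact KI_nonneg_of_nonneg (by linarith)

/-- `E ≤ 0` wherever `0 ≤ f ≤ 1`, i.e. for `θ² ≤ 500/11`. [instance data] -/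
theorem EI_nonpos {θ : ℝ} (hf : 0 ≤ fI θ) : EI θ ≤ 0 := by
  rw [EI_eq]
  have hK := KI_nonneg θ
  have hf1 : fI θ ≤ 1 := by unfold fI; nlinarith [sq_nonneg θ]
  nlinarith [sq_nonneg (SAlpha.bending 1 (2 / 5) θ), mul_nonneg hf hK]

/-! ### §3 The Riccati residual and the window -/

/-- `f > 0` on the two-turn window `[−2π, 2π]` (indeed `f ≥ 0.12`). [instance data] -/
theorem fI_pos {θ : ℝ} (hθ : θ ∈ Icc (-(2 * π)) (2 * π)) : 0 < fI θ := by
  have hπ := Real.pi_lt_d2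
  have h2 : θ ^ 2 ≤ (2 * π) ^ 2 := by
    have := abs_le.2 ⟨hθ.1, hθ.2⟩
    calc θ ^ 2 = |θ| ^ 2 := (sq_abs θ).symm
      _ ≤ (2 * π) ^ 2 := pow_le_pow_left₀ (abs_nonneg θ) this 2
  unfold fI
  nlinarith [Real.pi_pos]

/-- `(1+Λ²)·w` written without the quotient by `1+Λ²`: `= −(11/250)θ(1+Λ²)/f − ΛΛ′`. [instance data] -/
theorem bending_mul_wI (θ : ℝ) :
    SAlpha.bending 1 (2 / 5) θ * wI θ
      = -(11 / 250) * θ * SAlpha.bending 1 (2 / 5) θ / fI θ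
        - SAlpha.shearParam 1 (2 / 5) θ * SAlpha.localShear 1 (2 / 5) θ := by
  have hp : SAlpha.bending 1 (2 / 5) θ ≠ 0 := (SAlpha.bending_pos 1 (2 / 5) θ).ne'
  unfold wI
  field_simp

/-- The derivative of `(1+Λ²)w` is `pwI'` (where `f ≠ 0`). [instance data] -/
theorem hasDerivAt_bending_mul_wI {θ : ℝ} (hf : fI θ ≠ 0) :
    HasDerivAt (fun θ => SAlpha.bending 1 (2 / 5) θ * wI θ) (pwI' θ) θ := by
  have e : (fun θ => SAlpha.bending 1 (2 / 5) θ * wI θ)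
      = fun θ => -(11 / 250) * θ * SAlpha.bending 1 (2 / 5) θ / fI θ
          - SAlpha.shearParam 1 (2 / 5) θ * SAlpha.localShear 1 (2 / 5) θ := funext bending_mul_wI
  rw [e]
  have hΛ : HasDerivAt (SAlpha.shearParam 1 (2 / 5)) (SAlpha.localShear 1 (2 / 5) θ) θ :=
    SAlpha.hasDerivAt_shearParam 1 (2 / 5) θ
  have hΛ' : HasDerivAt (SAlpha.localShear 1 (2 / 5)) (2 / 5 * Real.sin θ) θ := by
    unfold SAlpha.localShear
    have h := (Real.hasDerivAt_cos θ).const_mul (2 / 5 : ℝ)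
    have h2 := h.const_sub (1 : ℝ)
    refine h2.congr_deriv ?_
    ring
  have hp : HasDerivAt (SAlpha.bending 1 (2 / 5))
      (2 * SAlpha.shearParam 1 (2 / 5) θ * SAlpha.localShear 1 (2 / 5) θ) θ := by
    unfold SAlpha.bending
    have h := (hΛ.mul hΛ).const_add (1 : ℝ)
    have e2 : (fun θ => 1 + SAlpha.shearParam 1 (2 / 5) θ ^ 2)
        = fun θ => 1 + SAlpha.shearParam 1 (2 / 5) θ * SAlpha.shearParam 1 (2 / 5) θ := by
      funext y; ring
    rw [e2]
    refine h.congr_deriv ?_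
    ring
  have hf' : HasDerivAt fI (-(11 / 250) * θ) θ := by
    unfold fI
    have h := ((hasDerivAt_id' θ).mul (hasDerivAt_id' θ)).const_mul (11 / 500 : ℝ)
    have h2 := h.const_sub (1 : ℝ)
    have e3 : (fun θ : ℝ => 1 - 11 / 500 * θ ^ 2) = fun θ => 1 - 11 / 500 * (θ * θ) := by funext y; ring
    rw [e3]
    refine h2.congr_deriv ?_
    ring
  have h1 := (((hasDerivAt_id' θ).const_mul (-(11 / 250) : ℝ)).mul hp).div hf' hf
  have h := h1.sub (hΛ.mul hΛ')
  refine h.congr_deriv ?_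
  unfold pwI'
  simp only [Pi.mul_apply]
  field_simp
  ring

/-- THE RICCATI RESIDUAL IS `E/(p f)` (pure algebra, no `sin² + cos² = 1`; `f ≠ 0`). [instance data] -/
theorem riccati_eq {θ : ℝ} (hf : fI θ ≠ 0) :
    SAlphaRiccati.riccati 1 (2 / 5) wI pwI' θ = EI θ / (SAlpha.bending 1 (2 / 5) θ * fI θ) := by
  have hp : SAlpha.bending 1 (2 / 5) θ ≠ 0 := (SAlpha.bending_pos 1 (2 / 5) θ).ne'
  unfold SAlphaRiccati.riccati wI pwI' EI SAlpha.drive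
  unfold SAlpha.bending at hp ⊢
  field_simp
  unfold SAlpha.localShear SAlpha.shearParam
  ring

/-- `Ric ≤ 0` on the two-turn window. [instance data] -/
theorem riccati_nonpos {θ : ℝ} (hθ : θ ∈ Icc (-(2 * π)) (2 * π)) :
    SAlphaRiccati.riccati 1 (2 / 5) wI pwI' θ ≤ 0 := by
  have hf := fI_pos hθ
  have hp := SAlpha.bending_pos 1 (2 / 5) θ
  rw [riccati_eq hf.ne']
  exact div_nonpos_iff.2 (Or.inr ⟨EI_nonpos hf.le, by positivity⟩)

/-- `w` is continuous on the window. [instance data] -/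
theorem continuousOn_wI : ContinuousOn wI (Icc (-(2 * π)) (2 * π)) := by
  have hfne : ∀ θ ∈ Icc (-(2 * π)) (2 * π), fI θ ≠ 0 := fun θ hθ => (fI_pos hθ).ne'
  have hpne : ∀ θ ∈ Icc (-(2 * π)) (2 * π), SAlpha.bending 1 (2 / 5) θ ≠ 0 :=
    fun θ _ => (SAlpha.bending_pos 1 (2 / 5) θ).ne'
  have hΛc : Continuous (SAlpha.shearParam 1 (2 / 5)) := by unfold SAlpha.shearParam; fun_prop
  have hΛ'c : Continuous (SAlpha.localShear 1 (2 / 5)) := by unfold SAlpha.localShear; fun_prop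
  have hpc : Continuous (SAlpha.bending 1 (2 / 5)) := SAlphaRiccati.continuous_bending 1 (2 / 5)
  have hfc : Continuous fI := by unfold fI; fun_prop
  unfold wI
  fun_prop (disch := assumption)

/-- `pwI'` is continuous on the window. [instance data] -/
theorem continuousOn_pwI' : ContinuousOn pwI' (Icc (-(2 * π)) (2 * π)) := by
  have hfne : ∀ θ ∈ Icc (-(2 * π)) (2 * π), fI θ ^ 2 ≠ 0 := fun θ hθ => pow_ne_zero 2 (fI_pos hθ).ne'
  have hΛc : Continuous (SAlpha.shearParam 1 (2 / 5)) := by unfold SAlpha.shearParam; fun_prop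
  have hΛ'c : Continuous (SAlpha.localShear 1 (2 / 5)) := by unfold SAlpha.localShear; fun_prop
  have hpc : Continuous (SAlpha.bending 1 (2 / 5)) := SAlphaRiccati.continuous_bending 1 (2 / 5)
  have hfc : Continuous fI := by unfold fI; fun_prop
  unfold pwI'
  fun_prop (disch := assumption)

/-- **(A) NON-NEGATIVE ENERGY ON THE TWO-TURN WINDOW**: at `(s, α) = (1, 2/5)`, every `X` differentiable on
`[a, b] ⊆ [−2π, 2π]` with `X(a) = X(b) = 0` and integrable energy density has `0 ≤ W[X; a, b]`.  MODEL `s–α`; nothing about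
a device. [instance data] -/
theorem energy_nonneg_window {a b : ℝ} {X X' : ℝ → ℝ} (ha : -(2 * π) ≤ a) (hb : b ≤ 2 * π) (hab : a ≤ b)
    (hX : ∀ θ ∈ uIcc a b, HasDerivAt X (X' θ) θ) (hXa : X a = 0) (hXb : X b = 0)
    (hint : IntervalIntegrable (fun θ => SAlpha.energyDensity 1 (2 / 5) X X' θ) volume a b) :
    0 ≤ SAlpha.energy 1 (2 / 5) X X' a b := by
  have hI : uIcc a b = Icc a b := uIcc_of_le hab
  have hsub : uIcc a b ⊆ Icc (-(2 * π)) (2 * π) := by rw [hI]; exact Icc_subset_Icc ha hb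
  exact SAlphaRiccati.energy_nonneg_of_riccati hab hX
    (fun _ hθ => hasDerivAt_bending_mul_wI (fI_pos (hsub hθ)).ne')
    (continuousOn_wI.mono hsub) (continuousOn_pwI'.mono hsub)
    (fun _ hθ => riccati_nonpos (hsub hθ)) hXa hXb hint

/-- **(B) THE ROW: NO INSTABILITY WITNESS IN THE TWO-TURN WINDOW** — at `(s, α) = (1, 2/5)` there is no
`SAlpha.UnstableWitness 1 (2/5) a b X X′` with `[a, b] ⊆ [−2π, 2π]`: no compactly supported trial function inside the window
has negative one-surface energy (contrast ★ #192's `unstableWitness_tt_one_067` at `(1, 67/100)` on the same window).  MODEL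
`s–α`; «stable» here is the window statement only; nothing about a device. [instance data] -/
theorem not_unstableWitness_window {a b : ℝ} {X X' : ℝ → ℝ} (ha : -(2 * π) ≤ a) (hb : b ≤ 2 * π) :
    ¬ SAlpha.UnstableWitness 1 (2 / 5) a b X X' :=
  SAlphaRiccati.not_unstableWitness_of_riccati ha hb
    (fun _ hθ => hasDerivAt_bending_mul_wI (fI_pos hθ).ne') continuousOn_wI continuousOn_pwI'
    (fun _ hθ => riccati_nonpos hθ)

end SAlphaStableWindow

end Summit.Ventures.FusionMHD.Models

end
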